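import Summits.ValiantsHypothesis.ValiantsHypothesis.Theorems.GeneratorObstructionsPerGenDegreeSuperQPRectangularAtom

/-!
# Route GeneratorObstructions — K1 `PerGenDegreeSuperQP` (stmt-ValiantsHypothesis-11654),
# line `per-side-atoms`: RECTANGULAR RAYS of the occurrence monoid start with an atom;
# `stub_atomLate` ⇐ a late start on any rectangular ray

Fifth support file of the line (companions `…AtomCertificates`, `…RectangularAtom`,
`…AtomsGenerate`, `…MinimalDegree`). The dominant cone of `GL_{m²}`-weights (in the coordinate-ring
convention: `λ^*`, `λ` a partition with `≤ m²` parts) has the extremal rays `ℝ₊ (1^j)^*`,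
`1 ≤ j ≤ m²`; on each of them the occurrence monoid `S(f)` of ANY orbit closure `ℂ[Δ_n[f]]` on the
lexicographic matrix variables starts — if it meets the ray at all — with an ATOM:

1. `partitionWeightLex_rectangle_apply`, `size_partitionWeightLex_rectangle`: the rectangular weight
   `(k^j)^*` is `-k` on the `j` greatest matrix indices, of size `-(jk)` (degree `jk/n`).
2. `eq_rectangle_of_add_eq_rectangle`: two dominant nonpositive weights summing to `(k^j)^*` are
   `(k₁^j)^*`, `(k₂^j)^*` with `k₁ + k₂ = k` (extremality of the ray).
3. `exists_least_rectangle_atom`: hence the LEAST `k₀ ≥ 1` with `(k₀^j)^*` occurring is an atom of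
   `S(f)` (given that some `(k^j)^*`, `k ≥ 1`, occurs). For `j = m²` this is the fundamental-
   invariant atom of `…RectangularAtom` / `…MinimalDegree` (degree `e(per_m)`); the top ray is
   always hit for `per_m` (`per_top_ray_hit`).
4. `stub_atomLate_of_late_rectangle`: the registered `stub_atomLate` holds VERBATIM as soon as, for
   every `c` and infinitely many `m`, SOME ray `j ≤ m²` of `S(per_m)` is hit but only in degree
   `jk/m > 2^((log₂ m + c)^c)` — `m²` candidate mechanisms instead of one. For `m < j < m²` no
   first-occurrence degree `k_j(per_m)` is known in print (for `j ≤ m` the Chow variety inside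
   `Δ(per_m)` makes early occurrence plausible, BHI 2017; for `j = m²`, `k = m` is expected along
   even `m`, BI 2017 Prop. 3.28). Cheapest test (not run: no compute in this seat): the first
   occurrence degrees on the rays `j = 4, …, 8` of `S(per_3) ⊂ ℤ^9`.

Honest framing: conditional reductions and structure lemmas; `stub_atomLate`, K1 (`c ≥ 2`) and
`GenFlipThesis` remain OPEN; nothing here bears on VP versus VNP.
References: [BurgisserIkenmeyer2017] §3.3, Prop. 3.28; [BurgisserHuttenhainIkenmeyer2017]
(arXiv:1501.05528) Thm. 1 (saturation via the Chow variety).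
-/

set_option linter.dupNamespace false

noncomputable section

namespace Summit.ValiantsHypothesis.ValiantsHypothesis.Theorems.GeneratorObstructions.PerGenDegreeSuperQP

open MvPolynomial
open Literature.NumberTheory.DiophantineGeometry Literature.Computability.AlgebraicComplexity
  Literature.Computability.Complexity

variable {m : ℕ}

/-! ### 1. The rectangular weights `(k^j)^*` on the lexicographic matrix variables -/

/-- Entries of the rectangular weight `(k^j)^* = partitionWeightLex m (rectangle j k)`: `-k` at the
`j` greatest matrix indices, `0` elsewhere. [folklore] -/
theorem partitionWeightLex_rectangle_apply (j k : ℕ) (x : MatIdx m) :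
    partitionWeightLex m (Nat.Partition.rectangle j k) x =
      if (((revMatIdx m).symm x : Fin (m * m)) : ℕ) < j then -(k : ℤ) else 0 := by
  have h := neg_partitionWeightLex_revMatIdx m (Nat.Partition.rectangle j k) ((revMatIdx m).symm x)
  rw [Equiv.apply_symm_apply, ofPartition_rectangle] at h
  dsimp only at h
  split_ifs at h ⊢ with hlt
  · have := h; omega
  · have := h; omega

/-- The rectangular weight `(k^j)^*` has size `-(j k)` (`j ≤ m²`). [folklore] -/
theorem size_partitionWeightLex_rectangle {j : ℕ} (hj : j ≤ m * m) (k : ℕ) :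
    (partitionWeightLex m (Nat.Partition.rectangle j k)).size = -((j * k : ℕ) : ℤ) := by
  rw [partitionWeightLex, Weight.size_toMatIdx, Weight.dualOfPartition, Weight.size_dual,
    Weight.size_ofPartition_holds ((Nat.Partition.card_parts_rectangle_le j k).trans hj)]

/-- `(k^j)^*` is nonzero for `j, k ≥ 1`, `j ≤ m²`. [folklore] -/
theorem partitionWeightLex_rectangle_ne_zero {j k : ℕ} (hj : 0 < j) (hjm : j ≤ m * m) (hk : 0 < k) :
    partitionWeightLex m (Nat.Partition.rectangle j k) ≠ 0 := by
  intro h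
  have hs := size_partitionWeightLex_rectangle hjm k
  rw [h] at hs
  simp [Weight.size] at hs
  rcases hs with h | h <;> omega

/-- **Splittings of a rectangular weight are rectangular.** If two dominant nonpositive weights sum
to `(k^j)^*` (`0 < j ≤ m²`), they are `(k₁^j)^*` and `(k₂^j)^*` with `k₁ + k₂ = k`: beyond the
`j` top indices both vanish (nonpositive summands of `0`); on them each summand is weakly monotone
with equal end values, hence constant. [folklore] -/
theorem eq_rectangle_of_add_eq_rectangle {j k : ℕ} (hj : 0 < j) (hjm : j ≤ m * m)
    {χ ψ : Weight (MatIdx m)} (hχ : χ.IsDominant) (hχ0 : ∀ x, χ x ≤ 0)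
    (hψ : ψ.IsDominant) (hψ0 : ∀ x, ψ x ≤ 0)
    (h : χ + ψ = partitionWeightLex m (Nat.Partition.rectangle j k)) :
    ∃ k₁ k₂ : ℕ, k₁ + k₂ = k ∧ χ = partitionWeightLex m (Nat.Partition.rectangle j k₁) ∧
      ψ = partitionWeightLex m (Nat.Partition.rectangle j k₂) := by
  set ρ := revMatIdx m with hρ
  have hρanti : StrictAnti ρ := strictAnti_revMatIdx m
  -- values along `ρ`
  have hsum : ∀ i : Fin (m * m), χ (ρ i) + ψ (ρ i) = if (i : ℕ) < j then -(k : ℤ) else 0 := by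
    intro i
    have := congrFun h (ρ i)
    rw [Pi.add_apply, partitionWeightLex_rectangle_apply, Equiv.symm_apply_apply] at this
    exact this
  -- monotonicity along `ρ`: `i ≤ i' → χ (ρ i) ≤ χ (ρ i')`
  have hmono : ∀ {θ : Weight (MatIdx m)}, θ.IsDominant → ∀ i i' : Fin (m * m), i ≤ i' →
      θ (ρ i) ≤ θ (ρ i') := fun hθ i i' hii' => hθ (hρanti.antitone hii')
  have hN : 0 < m * m := lt_of_lt_of_le hj hjm
  set i₀ : Fin (m * m) := ⟨0, hN⟩ with hi₀
  set i₁ : Fin (m * m) := ⟨j - 1, by omega⟩ with hi₁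
  -- the constants
  have h0 := hsum i₀
  have h1 := hsum i₁
  rw [if_pos (show ((i₀ : Fin (m * m)) : ℕ) < j from by simp [hi₀]; exact hj)] at h0
  rw [if_pos (show ((i₁ : Fin (m * m)) : ℕ) < j from by simp [hi₁]; omega)] at h1
  have hχle := hmono hχ i₀ i₁ (by simp [hi₀, hi₁, Fin.le_def])
  have hψle := hmono hψ i₀ i₁ (by simp [hi₀, hi₁, Fin.le_def])
  obtain ⟨k₁, hk₁⟩ : ∃ k₁ : ℕ, χ (ρ i₀) = -(k₁ : ℤ) := ⟨(-χ (ρ i₀)).toNat, by have := hχ0 (ρ i₀); omega⟩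
  obtain ⟨k₂, hk₂⟩ : ∃ k₂ : ℕ, ψ (ρ i₀) = -(k₂ : ℤ) := ⟨(-ψ (ρ i₀)).toNat, by have := hψ0 (ρ i₀); omega⟩
  refine ⟨k₁, k₂, by have := h0; omega, ?_, ?_⟩
  · funext x
    rw [partitionWeightLex_rectangle_apply]
    set i := (revMatIdx m).symm x with hi
    have hx : x = ρ i := by rw [hi, hρ, Equiv.apply_symm_apply]
    rw [hx]
    split_ifs with hlt
    · -- `χ` is constant on the top block: sandwiched between its values at `i₀` and `i₁`
      have ha := hmono hχ i₀ i (by simp [hi₀, Fin.le_def])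
      have hb := hmono hχ i i₁ (by simp [hi₁, Fin.le_def]; omega)
      have hc := hmono hψ i₀ i (by simp [hi₀, Fin.le_def])
      have hd := hmono hψ i i₁ (by simp [hi₁, Fin.le_def]; omega)
      omega
    · have hs := hsum i
      rw [if_neg hlt] at hs
      have := hχ0 (ρ i)
      have := hψ0 (ρ i)
      omega
  · funext x
    rw [partitionWeightLex_rectangle_apply]
    set i := (revMatIdx m).symm x with hi
    have hx : x = ρ i := by rw [hi, hρ, Equiv.apply_symm_apply]
    rw [hx]
    split_ifs with hlt
    · have ha := hmono hχ i₀ i (by simp [hi₀, Fin.le_def])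
      have hb := hmono hχ i i₁ (by simp [hi₁, Fin.le_def]; omega)
      have hc := hmono hψ i₀ i (by simp [hi₀, Fin.le_def])
      have hd := hmono hψ i i₁ (by simp [hi₁, Fin.le_def]; omega)
      have hs := hsum i
      rw [if_pos hlt] at hs
      omega
    · have hs := hsum i
      rw [if_neg hlt] at hs
      have := hχ0 (ρ i)
      have := hψ0 (ρ i)
      omega

/-! ### 2. The least occurring weight on a rectangular ray is an atom -/

/-- **Rectangular rays start with an atom.** Let `f` be any polynomial on `MatIdx m` and
`0 < j ≤ m²`. If some rectangular weight `(k^j)^*`, `k ≥ 1`, occurs in `ℂ[Δ_n[f]]`, then for the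
LEAST such `k₀` the weight `(k₀^j)^*` is an ATOM of the occurrence monoid: a splitting into nonzero
occurring weights would consist of rectangles `(k₁^j)^*, (k₂^j)^*` with `k₁ + k₂ = k₀`, `kᵢ ≥ 1`
(`eq_rectangle_of_add_eq_rectangle`), contradicting minimality. (The ray `ℝ₊(1^j)^*` is extremal
in the dominant cone; this is the extremal-ray principle for atoms of a submonoid.) [folklore] -/
theorem exists_least_rectangle_atom (f : MvPolynomial (MatIdx m) ℂ) (n : ℕ) {j : ℕ} (hj : 0 < j)
    (hjm : j ≤ m * m)
    (hex : ∃ k : ℕ, 0 < k ∧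
      highestWeightSpace (orbitCoordRep f n) (partitionWeightLex m (Nat.Partition.rectangle j k)) ≠ ⊥) :
    ∃ k₀ : ℕ, 0 < k₀ ∧
      highestWeightSpace (orbitCoordRep f n) (partitionWeightLex m (Nat.Partition.rectangle j k₀)) ≠ ⊥ ∧
      (∀ k : ℕ, 0 < k → k < k₀ →
        highestWeightSpace (orbitCoordRep f n) (partitionWeightLex m (Nat.Partition.rectangle j k)) = ⊥) ∧
      (∀ χ₁ χ₂ : Weight (MatIdx m), χ₁ + χ₂ = partitionWeightLex m (Nat.Partition.rectangle j k₀) →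
        χ₁ ≠ 0 → χ₂ ≠ 0 →
        highestWeightSpace (orbitCoordRep f n) χ₁ = ⊥ ∨ highestWeightSpace (orbitCoordRep f n) χ₂ = ⊥) := by
  classical
  haveI : Infinite ℂ := CharZero.infinite ℂ
  set k₀ := Nat.find hex with hk₀
  obtain ⟨hk₀pos, hocc⟩ := Nat.find_spec hex
  have hmin : ∀ k : ℕ, 0 < k → k < k₀ →
      highestWeightSpace (orbitCoordRep f n) (partitionWeightLex m (Nat.Partition.rectangle j k)) = ⊥ := by
    intro k hk hlt
    by_contra hne
    exact Nat.find_min hex hlt ⟨hk, hne⟩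
  refine ⟨k₀, hk₀pos, hocc, hmin, ?_⟩
  intro χ₁ χ₂ hsum h1 h2
  by_contra hne
  rw [not_or] at hne
  obtain ⟨hne1, hne2⟩ := hne
  have h1' : HasHighestWeight (orbitCoordRep f n) χ₁ := hne1
  have h2' : HasHighestWeight (orbitCoordRep f n) χ₂ := hne2
  obtain ⟨hle1, -⟩ := nonpos_and_exists_size_eq_of_hasHighestWeight_orbitCoordRep f h1'
  obtain ⟨hle2, -⟩ := nonpos_and_exists_size_eq_of_hasHighestWeight_orbitCoordRep f h2'
  have hdom1 := isDominant_of_hasHighestWeight_orbitCoordRep f h1'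
  have hdom2 := isDominant_of_hasHighestWeight_orbitCoordRep f h2'
  obtain ⟨k₁, k₂, hk, rfl, rfl⟩ :=
    eq_rectangle_of_add_eq_rectangle hj hjm hdom1 hle1 hdom2 hle2 hsum
  have hk₁ : 0 < k₁ := by
    rcases Nat.eq_zero_or_pos k₁ with h0 | h0
    · exfalso; apply h1; subst h0
      funext x; rw [partitionWeightLex_rectangle_apply]; simp
    · exact h0
  have hk₂ : 0 < k₂ := by
    rcases Nat.eq_zero_or_pos k₂ with h0 | h0
    · exfalso; apply h2; subst h0
      funext x; rw [partitionWeightLex_rectangle_apply]; simp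
    · exact h0
  exact hne1 (hmin k₁ hk₁ (by omega))

/-! ### 3. The permanent: `stub_atomLate` from a late start on ANY rectangular ray -/

/-- **Late rectangles ⇒ late atoms.** If for every `c, m₀` some `m ≥ max(m₀, 1)` has a rectangular
ray `j ∈ (0, m²]` of `S(per_m)` that is HIT (`(k^j)^*` occurs for some `k ≥ 1`) but only late
(every occurring `(k^j)^*` has degree `j k / m > 2^((log₂ m + c)^c)`), then the registered
`stub_atomLate` holds verbatim — the first weight on that ray is the witness
(`exists_least_rectangle_atom`). The ray `j = m²` is the fundamental-invariant ray of the
companion files (first point at degree `e(per_m) ≥ m²`); for `m < j < m²` no first-occurrence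
degree is known in print — the natural computational test is `m = 3`, `j = 4, …, 8`.
[cite: BurgisserIkenmeyer2017, §3.3] -/
theorem stub_atomLate_of_late_rectangle
    (H : ∀ c m₀ : ℕ, ∃ m : ℕ, m₀ ≤ m ∧ 1 ≤ m ∧ ∃ j : ℕ, 0 < j ∧ j ≤ m * m ∧
      (∃ k : ℕ, 0 < k ∧
        highestWeightSpace (orbitCoordRep (MvPolynomial.rename toLex (perPoly (Fin m) ℂ)) m)
          (partitionWeightLex m (Nat.Partition.rectangle j k)) ≠ ⊥) ∧
      (∀ k : ℕ, 0 < k →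
        highestWeightSpace (orbitCoordRep (MvPolynomial.rename toLex (perPoly (Fin m) ℂ)) m)
          (partitionWeightLex m (Nat.Partition.rectangle j k)) ≠ ⊥ →
        m * 2 ^ ((Nat.log 2 m + c) ^ c) < j * k)) :
    ∀ c m₀ : ℕ, ∃ m : ℕ, m₀ ≤ m ∧ 1 ≤ m ∧ ∃ χ : Weight (MatIdx m),
      highestWeightSpace (orbitCoordRep (MvPolynomial.rename toLex (perPoly (Fin m) ℂ)) m) χ ≠ ⊥ ∧
      (∀ χ₁ χ₂ : Weight (MatIdx m), χ₁ + χ₂ = χ → χ₁ ≠ 0 → χ₂ ≠ 0 →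
          highestWeightSpace (orbitCoordRep (MvPolynomial.rename toLex (perPoly (Fin m) ℂ)) m) χ₁ = ⊥ ∨
            highestWeightSpace (orbitCoordRep (MvPolynomial.rename toLex (perPoly (Fin m) ℂ)) m) χ₂ = ⊥) ∧
      (m : ℤ) * 2 ^ ((Nat.log 2 m + c) ^ c) < -(Weight.size χ) := by
  intro c m₀
  obtain ⟨m, hm₀, hm, j, hj, hjm, hex, hlate⟩ := H c m₀
  obtain ⟨k₀, hk₀, hocc, -, hatom⟩ :=
    exists_least_rectangle_atom (rename toLex (perPoly (Fin m) ℂ)) m hj hjm hex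
  refine ⟨m, hm₀, hm, _, hocc, hatom, ?_⟩
  rw [size_partitionWeightLex_rectangle hjm, neg_neg]
  exact_mod_cast hlate k₀ hk₀ hocc

/-- **The top ray is always hit**: for `m ≥ 1` the constant weight `-k·𝟙 = (k^{m²})^*` occurs for
some `k ≥ 1` (companion file `per_exists_hasHighestWeight_const`, polystability of `per_m`), so the
hypothesis of `stub_atomLate_of_late_rectangle` at `j = m²` reduces to lateness alone — there it
reads `e(per_m) > 2^((log₂ m + c)^c)` (companion `…MinimalDegree`). [cite: BurgisserIkenmeyer2017, Cor. 2.9] -/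
theorem per_top_ray_hit (hm : 1 ≤ m) :
    ∃ k : ℕ, 0 < k ∧
      highestWeightSpace (orbitCoordRep (MvPolynomial.rename toLex (perPoly (Fin m) ℂ)) m)
        (partitionWeightLex m (Nat.Partition.rectangle (m * m) k)) ≠ ⊥ := by
  obtain ⟨k, hk, h⟩ := per_exists_hasHighestWeight_const hm
  refine ⟨k, hk, ?_⟩
  have hconst : partitionWeightLex m (Nat.Partition.rectangle (m * m) k) = fun _ : MatIdx m => -(k : ℤ) := by
    funext x
    rw [partitionWeightLex_rectangle_apply, if_pos ((revMatIdx m).symm x).is_lt]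
  rw [hconst]
  exact h

end Summit.ValiantsHypothesis.ValiantsHypothesis.Theorems.GeneratorObstructions.PerGenDegreeSuperQP

end
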